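import Summits.Ventures.HSemireg.DimZeroUnitsClassDeadFive
import Summits.Ventures.HSemireg.DividedSquareParity

/-!
# LEMMA F for EVERY integral class 2-form (pub-hsemireg, S4-PUSH corner 2)

Kernel leg of seat s4-search-2 gen 17 (cell `pub-hsemireg`), ROW R; composition of ROWS N2 ∕ N3
(`DimZeroUnitsClassDead.classDead_c222234`, `DimZeroUnitsClassDeadFive.classDead_c222225`: LEMMA F — the dimension-0
`E = ∅` units of the types `(2,2,2,2,3,4)` ∕ `(2,2,2,2,2,5)` fail CRITERION L at `k = 3` or `k = 4` for every leading
digit `β = ι a ι b` of rank `≤ 2`) with ROWS O ∕ P (`DecomposableTwoForms`, `DividedSquareParity`).  On these units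
CRITERION L at `k = 2` is where the rank condition comes from: with the registered `T₂ = σ₂D₂ − 4σ₁DB + 16σ₀B₂`,
`σ₁ = 0`, `σ₂ = 4t + 2`, `σ₀ = 2s + 1` and `D₂ = 16E₂` (the type's closed form, N1 `DimZeroClosedForms.sq_D_c34 ∕ _c25`
transported through the commutative 2-vector subalgebra, cancel `2`), `T₂ = 32·W₁ + 16·B₂`; so `T₂ ∈ 64Λ` gives
`B·B ∈ 4Λ` and `DividedSquareParity.exists_eq_ι_mul_ι_add_two_mul_of_sq` writes `B = ι a ι b + 2X`, whereupon N2 ∕ N3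
apply verbatim.  Hence `classDead_c222234_of_mem_span` ∕ `classDead_c222225_of_mem_span`: for ANY `B` in the `ℤ`-span of
the 2-vectors, `¬(T₂ = 64Z₂ ∧ T₃ = 1024Z₃ ∧ T₄ = 16384Z₄)` — CRITERION L fails at `k = 2`, `3` or `4`, with no
leading-digit hypothesis (precision S-N-2 of s4-ref g48 V#7 discharged inside the kernel).

Scope ∕ honest framing as in ROW N2: CLASS-LEVEL statements for two unit types of a NECESSARY-condition sieve
(CRITERION L) at the special fibre `E⁶`; that CRITERION L is the registered necessary condition, the signature table
(`σ₁ = 0`, `v₂(σ₀, σ₂, σ₃, σ₄) = (0, 1, ≥ 2, 2)` on these 89 class-units) and the census remain framework words;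
theorems only (count-neutral, no `def`); no object, no `σ` computation, no Hodge statement; nothing here bears on
HC ∕ HC_CM ∕ HC_AV.
-/

namespace Summit.Ventures.HSemireg.DimZeroEveryDigit

open ExteriorAlgebra TwoSlotFrameTable LeadingDigitRemainder DimZeroClosedForms DimZeroUnitsClassDead
  DimZeroUnitsClassDeadFive DividedSquareParity
open scoped IsMulCommutative

variable {M : Type*} [AddCommGroup M] [Module ℤ M]

/-- Cancelling `2` (torsion-freeness, `LeadingDigitRemainder.natCast_mul_cancel`); a `private` local copy — the landed
`DimZeroUnitsClassDead.cancel_2` is `private` and `MixedFrameClassDead.cancel_two` is not imported by this row (v2: keeper-filer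
repair of the `Unknown identifier cancel_2` bounce; statements of record unchanged). -/
private theorem cancel_2 (x : Module.Basis (Fin 12) ℤ M) {Q Q' : ExteriorAlgebra ℤ M}
    (h : (2 : ExteriorAlgebra ℤ M) * Q = 2 * Q') : Q = Q' :=
  natCast_mul_cancel x 2 (by norm_num) Q Q' (by exact_mod_cast h)

set_option maxHeartbeats 800000 in
/-- **LEMMA F, type (2,2,2,2,3,4), WITHOUT THE LEADING-DIGIT HYPOTHESIS.**  Setting of
`DimZeroUnitsClassDead.classDead_c222234`, but the class 2-form `B` is ANY element of the `ℤ`-span of the 2-vectors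
with intrinsic `B₂, B₃, B₄`, the signature also carries `σ₀ = 2s + 1` (`s` any element) and the registered
`T₂(B) = σ₂D₂ − 4σ₁DB + 16σ₀B₂` of `k = 2`.  THEN CRITERION L fails at `k = 2`, `3` or `4`:
`¬(T₂ = 64·Z₂ ∧ T₃ = 1024·Z₃ ∧ T₄ = 16384·Z₄)` for all `Z₂, Z₃, Z₄`.  Proof: `D₂ = 16E₂` (N1's closed form, cancel
`2`), so `T₂ = 32·W₁ + 16·B₂`; `T₂ = 64Z₂` forces `B₂ = 2(2Z₂ − W₁)`, `B·B ∈ 4Λ`, and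
`DividedSquareParity.exists_eq_ι_mul_ι_add_two_mul_of_sq` makes `B = ι a ι b + 2X`; then `classDead_c222234`. -/
theorem classDead_c222234_of_mem_span (x : Module.Basis (Fin 12) ℤ M)
    (h₀ h₁ h₂ h₃ h₄ h₅ σ₀ σ₁ σ₂ σ₃ σ₄ s t u w D D₂ D₃ D₄ B B₂ B₃ B₄ T₂ T₃ T₄ : ExteriorAlgebra ℤ M)
    (hh₀ : h₀ = ι ℤ (x 0) * ι ℤ (x 1)) (hh₁ : h₁ = ι ℤ (x 2) * ι ℤ (x 3)) (hh₂ : h₂ = ι ℤ (x 4) * ι ℤ (x 5))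
    (hh₃ : h₃ = ι ℤ (x 6) * ι ℤ (x 7)) (hh₄ : h₄ = ι ℤ (x 8) * ι ℤ (x 9)) (hh₅ : h₅ = ι ℤ (x 10) * ι ℤ (x 11))
    (hD : D = 4 * (h₀ + h₁ + h₂ + h₃) + 8 * h₄ + 16 * h₅)
    (qD : D * D = 2 * D₂) (cD : D * D * D = 6 * D₃) (fD : D * D * D * D = 24 * D₄)
    (mB : B ∈ Submodule.span ℤ (Set.range fun p : M × M => ι ℤ p.1 * ι ℤ p.2))
    (qB : B * B = 2 * B₂) (cB : B * B * B = 6 * B₃) (fB : B * B * B * B = 24 * B₄)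
    (hσ₀ : σ₀ = 2 * s + 1) (hσ₁ : σ₁ = 0) (hσ₂ : σ₂ = 4 * t + 2) (hσ₃ : σ₃ = 4 * u) (hσ₄ : σ₄ = 8 * w + 4)
    (hT₂ : T₂ = σ₂ * D₂ - 4 * σ₁ * (D * B) + 16 * σ₀ * B₂)
    (hT₃ : T₃ = σ₃ * D₃ - 4 * σ₂ * (D₂ * B) + 16 * σ₁ * (D * B₂) - 64 * σ₀ * B₃)
    (hT₄ : T₄ = σ₄ * D₄ - 4 * σ₃ * (D₃ * B) + 16 * σ₂ * (D₂ * B₂) - 64 * σ₁ * (D * B₃) + 256 * σ₀ * B₄) :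
    ∀ Z₂ Z₃ Z₄ : ExteriorAlgebra ℤ M, ¬ (T₂ = 64 * Z₂ ∧ T₃ = 1024 * Z₃ ∧ T₄ = 16384 * Z₄) := by
  rintro Z₂ Z₃ Z₄ ⟨hcrit₂, hcrit₃, hcrit₄⟩
  haveI := TwoSlotGlue.isMulCommutative_twoVectorSubalgebra (R := ℤ) (M := M)
  set Λ := Algebra.adjoin ℤ (Set.range fun p : M × M => ι ℤ p.1 * ι ℤ p.2) with hΛ
  obtain ⟨P, hP⟩ : ∃ P : ExteriorAlgebra ℤ M, P = h₀ + h₁ + h₂ + h₃ := ⟨_, rfl⟩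
  obtain ⟨P₂, hP₂⟩ : ∃ P₂ : ExteriorAlgebra ℤ M,
    P₂ = h₀ * h₁ + h₀ * h₂ + h₀ * h₃ + h₁ * h₂ + h₁ * h₃ + h₂ * h₃ := ⟨_, rfl⟩
  obtain ⟨R₂, hR₂⟩ : ∃ R₂ : ExteriorAlgebra ℤ M, R₂ = P * h₄ + 2 * (P * h₅) + 4 * (h₄ * h₅) := ⟨_, rfl⟩
  obtain ⟨E₂, hE₂⟩ : ∃ E₂ : ExteriorAlgebra ℤ M, E₂ = P₂ + 2 * R₂ := ⟨_, rfl⟩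
  have mh₀ : h₀ ∈ Λ := Algebra.subset_adjoin ⟨(x 0, x 1), hh₀.symm⟩
  have mh₁ : h₁ ∈ Λ := Algebra.subset_adjoin ⟨(x 2, x 3), hh₁.symm⟩
  have mh₂ : h₂ ∈ Λ := Algebra.subset_adjoin ⟨(x 4, x 5), hh₂.symm⟩
  have mh₃ : h₃ ∈ Λ := Algebra.subset_adjoin ⟨(x 6, x 7), hh₃.symm⟩
  have mh₄ : h₄ ∈ Λ := Algebra.subset_adjoin ⟨(x 8, x 9), hh₄.symm⟩
  have mh₅ : h₅ ∈ Λ := Algebra.subset_adjoin ⟨(x 10, x 11), hh₅.symm⟩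
  have mP : P ∈ Λ := by rw [hP]; exact Λ.add_mem (Λ.add_mem (Λ.add_mem mh₀ mh₁) mh₂) mh₃
  have mD : D ∈ Λ := by
    rw [hD, ← hP]
    exact Λ.add_mem (Λ.add_mem (Λ.mul_mem (Λ.natCast_mem 4) mP) (Λ.mul_mem (Λ.natCast_mem 8) mh₄))
      (Λ.mul_mem (Λ.natCast_mem 16) mh₅)
  have q₀ : (⟨h₀, mh₀⟩ : Λ) * ⟨h₀, mh₀⟩ = 0 := Subtype.ext (by subst hh₀; exact twoVector_mul_self (x 0) (x 1))
  have q₁ : (⟨h₁, mh₁⟩ : Λ) * ⟨h₁, mh₁⟩ = 0 := Subtype.ext (by subst hh₁; exact twoVector_mul_self (x 2) (x 3))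
  have q₂ : (⟨h₂, mh₂⟩ : Λ) * ⟨h₂, mh₂⟩ = 0 := Subtype.ext (by subst hh₂; exact twoVector_mul_self (x 4) (x 5))
  have q₃ : (⟨h₃, mh₃⟩ : Λ) * ⟨h₃, mh₃⟩ = 0 := Subtype.ext (by subst hh₃; exact twoVector_mul_self (x 6) (x 7))
  have q₄ : (⟨h₄, mh₄⟩ : Λ) * ⟨h₄, mh₄⟩ = 0 := Subtype.ext (by subst hh₄; exact twoVector_mul_self (x 8) (x 9))
  have q₅ : (⟨h₅, mh₅⟩ : Λ) * ⟨h₅, mh₅⟩ = 0 :=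
    Subtype.ext (by subst hh₅; exact twoVector_mul_self (x 10) (x 11))
  -- `D₂ = 16E₂`
  have hDΛ : (⟨D, mD⟩ : Λ) = 4 * (⟨h₀, mh₀⟩ + ⟨h₁, mh₁⟩ + ⟨h₂, mh₂⟩ + ⟨h₃, mh₃⟩) + 8 * ⟨h₄, mh₄⟩
      + 16 * ⟨h₅, mh₅⟩ := Subtype.ext (by push_cast; exact hD)
  have k₂ := congrArg Subtype.val (sq_D_c34 (R := Λ) _ _ _ _ _ _ _ hDΛ q₀ q₁ q₂ q₃ q₄ q₅)
  push_cast at k₂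
  simp only [val_ofNat] at k₂
  have eD₂ : D₂ = 16 * E₂ := by
    have k : D * D = 2 * (16 * E₂) := by rw [k₂, hE₂, hR₂, hP₂, hP]; noncomm_ring
    exact cancel_2 x (qD.symm.trans k)
  -- `T₂ = 32·W₁ + 16·B₂`; `T₂ = 64Z₂` forces `B·B ∈ 4Λ`
  obtain ⟨W₁, hW₁⟩ : ∃ W₁ : ExteriorAlgebra ℤ M, W₁ = 2 * t * E₂ + E₂ + s * B₂ := ⟨_, rfl⟩
  have e : T₂ = 32 * W₁ + 16 * B₂ := by
    rw [hW₁, hT₂, hσ₁, hσ₂, hσ₀, eD₂]; noncomm_ring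
  have h16 : (16 : ExteriorAlgebra ℤ M) * B₂ = 16 * (2 * (2 * Z₂ - W₁)) := by
    rw [eq_sub_of_add_eq' (e.symm.trans hcrit₂)]; noncomm_ring
  have hB₂' : B₂ = 2 * (2 * Z₂ - W₁) := natCast_mul_cancel x 16 (by norm_num) _ _ (by exact_mod_cast h16)
  have hBB : B * B = 4 * (2 * Z₂ - W₁) := by rw [qB, hB₂']; noncomm_ring
  -- the leading digit is decomposable; LEMMA F
  obtain ⟨a, b, X, mX, hB⟩ := exists_eq_ι_mul_ι_add_two_mul_of_sq x B _ mB hBB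
  exact classDead_c222234 x h₀ h₁ h₂ h₃ h₄ h₅ σ₀ σ₁ σ₂ σ₃ σ₄ t u w D D₂ D₃ D₄ X B B₂ B₃ B₄ T₃ T₄ a b hh₀ hh₁
    hh₂ hh₃ hh₄ hh₅ hD qD cD fD mX hB qB cB fB hσ₁ hσ₂ hσ₃ hσ₄ hT₃ hT₄ Z₃ Z₄ ⟨hcrit₃, hcrit₄⟩

set_option maxHeartbeats 800000 in
/-- **LEMMA F, type (2,2,2,2,2,5), WITHOUT THE LEADING-DIGIT HYPOTHESIS** — the same for
`DimZeroUnitsClassDeadFive.classDead_c222225` (`D = 4(h₀ + ⋯ + h₄) + 32h₅`). -/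
theorem classDead_c222225_of_mem_span (x : Module.Basis (Fin 12) ℤ M)
    (h₀ h₁ h₂ h₃ h₄ h₅ σ₀ σ₁ σ₂ σ₃ σ₄ s t u w D D₂ D₃ D₄ B B₂ B₃ B₄ T₂ T₃ T₄ : ExteriorAlgebra ℤ M)
    (hh₀ : h₀ = ι ℤ (x 0) * ι ℤ (x 1)) (hh₁ : h₁ = ι ℤ (x 2) * ι ℤ (x 3)) (hh₂ : h₂ = ι ℤ (x 4) * ι ℤ (x 5))
    (hh₃ : h₃ = ι ℤ (x 6) * ι ℤ (x 7)) (hh₄ : h₄ = ι ℤ (x 8) * ι ℤ (x 9)) (hh₅ : h₅ = ι ℤ (x 10) * ι ℤ (x 11))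
    (hD : D = 4 * (h₀ + h₁ + h₂ + h₃ + h₄) + 32 * h₅)
    (qD : D * D = 2 * D₂) (cD : D * D * D = 6 * D₃) (fD : D * D * D * D = 24 * D₄)
    (mB : B ∈ Submodule.span ℤ (Set.range fun p : M × M => ι ℤ p.1 * ι ℤ p.2))
    (qB : B * B = 2 * B₂) (cB : B * B * B = 6 * B₃) (fB : B * B * B * B = 24 * B₄)
    (hσ₀ : σ₀ = 2 * s + 1) (hσ₁ : σ₁ = 0) (hσ₂ : σ₂ = 4 * t + 2) (hσ₃ : σ₃ = 4 * u) (hσ₄ : σ₄ = 8 * w + 4)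
    (hT₂ : T₂ = σ₂ * D₂ - 4 * σ₁ * (D * B) + 16 * σ₀ * B₂)
    (hT₃ : T₃ = σ₃ * D₃ - 4 * σ₂ * (D₂ * B) + 16 * σ₁ * (D * B₂) - 64 * σ₀ * B₃)
    (hT₄ : T₄ = σ₄ * D₄ - 4 * σ₃ * (D₃ * B) + 16 * σ₂ * (D₂ * B₂) - 64 * σ₁ * (D * B₃) + 256 * σ₀ * B₄) :
    ∀ Z₂ Z₃ Z₄ : ExteriorAlgebra ℤ M, ¬ (T₂ = 64 * Z₂ ∧ T₃ = 1024 * Z₃ ∧ T₄ = 16384 * Z₄) := by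
  rintro Z₂ Z₃ Z₄ ⟨hcrit₂, hcrit₃, hcrit₄⟩
  haveI := TwoSlotGlue.isMulCommutative_twoVectorSubalgebra (R := ℤ) (M := M)
  set Λ := Algebra.adjoin ℤ (Set.range fun p : M × M => ι ℤ p.1 * ι ℤ p.2) with hΛ
  obtain ⟨P, hP⟩ : ∃ P : ExteriorAlgebra ℤ M, P = h₀ + h₁ + h₂ + h₃ + h₄ := ⟨_, rfl⟩
  obtain ⟨P₂, hP₂⟩ : ∃ P₂ : ExteriorAlgebra ℤ M,
    P₂ = h₀ * h₁ + h₀ * h₂ + h₀ * h₃ + h₀ * h₄ + h₁ * h₂ + h₁ * h₃ + h₁ * h₄ + h₂ * h₃ + h₂ * h₄ + h₃ * h₄ := ⟨_, rfl⟩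
  obtain ⟨R₂, hR₂⟩ : ∃ R₂ : ExteriorAlgebra ℤ M, R₂ = 4 * (P * h₅) := ⟨_, rfl⟩
  obtain ⟨E₂, hE₂⟩ : ∃ E₂ : ExteriorAlgebra ℤ M, E₂ = P₂ + 2 * R₂ := ⟨_, rfl⟩
  have mh₀ : h₀ ∈ Λ := Algebra.subset_adjoin ⟨(x 0, x 1), hh₀.symm⟩
  have mh₁ : h₁ ∈ Λ := Algebra.subset_adjoin ⟨(x 2, x 3), hh₁.symm⟩
  have mh₂ : h₂ ∈ Λ := Algebra.subset_adjoin ⟨(x 4, x 5), hh₂.symm⟩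
  have mh₃ : h₃ ∈ Λ := Algebra.subset_adjoin ⟨(x 6, x 7), hh₃.symm⟩
  have mh₄ : h₄ ∈ Λ := Algebra.subset_adjoin ⟨(x 8, x 9), hh₄.symm⟩
  have mh₅ : h₅ ∈ Λ := Algebra.subset_adjoin ⟨(x 10, x 11), hh₅.symm⟩
  have mP : P ∈ Λ := by
    rw [hP]; exact Λ.add_mem (Λ.add_mem (Λ.add_mem (Λ.add_mem mh₀ mh₁) mh₂) mh₃) mh₄
  have mD : D ∈ Λ := by
    rw [hD, ← hP]
    exact Λ.add_mem (Λ.mul_mem (Λ.natCast_mem 4) mP) (Λ.mul_mem (Λ.natCast_mem 32) mh₅)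
  have q₀ : (⟨h₀, mh₀⟩ : Λ) * ⟨h₀, mh₀⟩ = 0 := Subtype.ext (by subst hh₀; exact twoVector_mul_self (x 0) (x 1))
  have q₁ : (⟨h₁, mh₁⟩ : Λ) * ⟨h₁, mh₁⟩ = 0 := Subtype.ext (by subst hh₁; exact twoVector_mul_self (x 2) (x 3))
  have q₂ : (⟨h₂, mh₂⟩ : Λ) * ⟨h₂, mh₂⟩ = 0 := Subtype.ext (by subst hh₂; exact twoVector_mul_self (x 4) (x 5))
  have q₃ : (⟨h₃, mh₃⟩ : Λ) * ⟨h₃, mh₃⟩ = 0 := Subtype.ext (by subst hh₃; exact twoVector_mul_self (x 6) (x 7))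
  have q₄ : (⟨h₄, mh₄⟩ : Λ) * ⟨h₄, mh₄⟩ = 0 := Subtype.ext (by subst hh₄; exact twoVector_mul_self (x 8) (x 9))
  have q₅ : (⟨h₅, mh₅⟩ : Λ) * ⟨h₅, mh₅⟩ = 0 :=
    Subtype.ext (by subst hh₅; exact twoVector_mul_self (x 10) (x 11))
  have hDΛ : (⟨D, mD⟩ : Λ) = 4 * (⟨h₀, mh₀⟩ + ⟨h₁, mh₁⟩ + ⟨h₂, mh₂⟩ + ⟨h₃, mh₃⟩ + ⟨h₄, mh₄⟩)
      + 32 * ⟨h₅, mh₅⟩ := Subtype.ext (by push_cast; exact hD)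
  have k₂ := congrArg Subtype.val (sq_D_c25 (R := Λ) _ _ _ _ _ _ _ hDΛ q₀ q₁ q₂ q₃ q₄ q₅)
  push_cast at k₂
  simp only [val_ofNat] at k₂
  have eD₂ : D₂ = 16 * E₂ := by
    have k : D * D = 2 * (16 * E₂) := by rw [k₂, hE₂, hR₂, hP₂, hP]; noncomm_ring
    exact cancel_2 x (qD.symm.trans k)
  obtain ⟨W₁, hW₁⟩ : ∃ W₁ : ExteriorAlgebra ℤ M, W₁ = 2 * t * E₂ + E₂ + s * B₂ := ⟨_, rfl⟩
  have e : T₂ = 32 * W₁ + 16 * B₂ := by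
    rw [hW₁, hT₂, hσ₁, hσ₂, hσ₀, eD₂]; noncomm_ring
  have h16 : (16 : ExteriorAlgebra ℤ M) * B₂ = 16 * (2 * (2 * Z₂ - W₁)) := by
    rw [eq_sub_of_add_eq' (e.symm.trans hcrit₂)]; noncomm_ring
  have hB₂' : B₂ = 2 * (2 * Z₂ - W₁) := natCast_mul_cancel x 16 (by norm_num) _ _ (by exact_mod_cast h16)
  have hBB : B * B = 4 * (2 * Z₂ - W₁) := by rw [qB, hB₂']; noncomm_ring
  obtain ⟨a, b, X, mX, hB⟩ := exists_eq_ι_mul_ι_add_two_mul_of_sq x B _ mB hBB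
  exact classDead_c222225 x h₀ h₁ h₂ h₃ h₄ h₅ σ₀ σ₁ σ₂ σ₃ σ₄ t u w D D₂ D₃ D₄ X B B₂ B₃ B₄ T₃ T₄ a b hh₀ hh₁
    hh₂ hh₃ hh₄ hh₅ hD qD cD fD mX hB qB cB fB hσ₁ hσ₂ hσ₃ hσ₄ hT₃ hT₄ Z₃ Z₄ ⟨hcrit₃, hcrit₄⟩

end Summit.Ventures.HSemireg.DimZeroEveryDigit
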